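import Mathlib
import Literature.Barriers.ValiantsHypothesis.AlgebraicNaturalProofs
import Summits.ValiantsHypothesis.ValiantsHypothesis.Theorems.BarrierLeverPartitionMinorsHitByVPHiddenStates

/-!
# Route BarrierLever — item `PartitionMinorsHitByVP` (stmt-ValiantsHypothesis-19717):
# the SIMPLEX-PRODUCT JOIN witness, part 1/2 — square-free coefficients and size

Helper file (`--supports stmt-ValiantsHypothesis-19717`; cell valiant-natproofs, rung V4, 𝒟-side door (c),
line `hidden_states`; prover seat val-np-p3 gen 11). Definition-free. Closes NO item. Part 2 (`…SimplexJoinDoor`) is the door.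

THE WITNESS. For `m` pieces, depth `D`, width `N`, live-vertex sets `S p f ⊆ Fin N` and tables
`tab p : Option (Fin D × Fin N) → σ → ℂ` (row `none` = the base point of piece `p`) put, with `E(t) = ∏_v (1 + t_v X_v)`,

  `F = Σ_p E(tab p none) · ∏_{f < D} (1 + Σ_{j ∈ S p f} E(tab p (f, j)))`.

Expanding the product over the factors `f` and taking a SQUARE-FREE coefficient (`coeff_simplexPiece`,
`coeff_partition_simplexJoin`) gives, on a partition layout `(u, w)`,

  `N[U, W] = Σ_{(p, g)} [g live] · α_{p,g}^U · β_{p,g}^W`,  `α_{p,g} = tx p none + Σ_f tx p (f, g f)`,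

the sum running over ALL `g : Fin D → Option (Fin N)` («vertex `g f` of the `f`-th simplex, or none») with the
indicator `[g live] = ∏_f [g f = none ∨ g f ∈ S p f]`. The live columns are EXACTLY the product of simplices
`∏_f ({none} ∪ S p f)`: a MINKOWSKI SUM of `D` simplices per piece. Hence, if a layout of size `r` is enumerated
by an injective `e : Fin r → Fin m × (Fin D → Option (Fin N))` whose range is precisely the live set, the layout
matrix is `A · Bᵀ` with BOTH factors SQUARE — `det = det A · det B` (`partitionMinor_hit_of_simplexJoin`); no
Cauchy–Binet leading term, no weights, no threshold («legality») condition. With `m ≤ (2h)²`, `D, N ≤ 2h`,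
`h ≥ 3` the truncated witness lies in `SmallCircuits ℂ (h+h) 9` (`partitionMinor_hit_of_simplexJoin_mem`).

WHY (val-np-p3 g11 memo): the registered join doors (`…HiddenStatesJoin`, `…StubJoinDoorWide`) generate each piece
by the FULL cube product `∏_q (1 + λ_q E_q)`, so every subset of states is a column and the design must be cut out
as the UNIQUE lightest `r`-set — a threshold family. Generating a piece by `∏_f (1 + Σ_{j∈S_f} E_{f,j})` instead
produces exactly `∏_f (|S_f|+1)` columns: designs may be products of simplices of any sizes (not down-sets of a
cube, not threshold), e.g. the base-`n` DIGIT JOIN (`r = Σ c_i n^i`, `c_i` copies of the `i`-fold Minkowski power of an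
`n`-simplex, `n = h+1`), which is GOOD for every down-set at `h ≤ 6` (exhaustive `h ≤ 5`) in the seat's census.

WHAT THIS IS NOT: no design is proved universal here; item 19717 stays OPEN; nothing on crux 14610 or VP ≠ VNP.
-/

set_option linter.dupNamespace false

namespace Summit.ValiantsHypothesis.ValiantsHypothesis.Theorems.BarrierLever.SimplexJoin

open Finset MvPolynomial Matrix
open Literature.Barriers.ValiantsHypothesis Literature.Computability.AlgebraicComplexity
open Summit.ValiantsHypothesis.ValiantsHypothesis.Theorems.BarrierLever.AdditiveDoor
  (coeff_squarefree_prod_one_add_C_mul_X truncation_spec degree_partitionExpo_le partitionExpo_le_one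
    complexity_one_add_C_mul_X_le)
open Summit.ValiantsHypothesis.ValiantsHypothesis.Theorems.BarrierLever.HiddenStates
  (prod_support_partitionExpo complexity_elemProd_le)

noncomputable section

/-! ## 1. Square-free coefficients of one simplex-product piece -/

section Coeff

variable {σ : Type*} [Fintype σ] [DecidableEq σ] {D N : ℕ}

omit [DecidableEq σ] in
/-- One factor `1 + Σ_{j ∈ S} E(t j)` as a sum over `Option (Fin N)` of weighted elementary products
(`none` ↦ the constant `1 = E(0)`, `some j` ↦ `[j ∈ S] · E(t j)`). -/
theorem one_add_sum_elemProd_eq (S : Finset (Fin N)) (t : Fin N → σ → ℂ) :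
    (1 + ∑ j ∈ S, ∏ v : σ, (1 + C (t j v) * X v) : MvPolynomial σ ℂ) =
      ∑ o : Option (Fin N), C (o.elim 1 fun j => if j ∈ S then 1 else 0) *
        ∏ v : σ, (1 + C (o.elim 0 fun j => t j v) * X v) := by
  have hnone : (C ((none : Option (Fin N)).elim (1 : ℂ) fun j => if j ∈ S then 1 else 0) *
      ∏ v : σ, (1 + C ((none : Option (Fin N)).elim (0 : ℂ) fun j => t j v) * X v) : MvPolynomial σ ℂ) = 1 := by
    simp [Option.elim]
  have hsome : ∀ j : Fin N, (C ((some j : Option (Fin N)).elim (1 : ℂ) fun j => if j ∈ S then 1 else 0) *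
      ∏ v : σ, (1 + C ((some j : Option (Fin N)).elim (0 : ℂ) fun j => t j v) * X v) : MvPolynomial σ ℂ) =
      if j ∈ S then ∏ v : σ, (1 + C (t j v) * X v) else 0 := by
    intro j
    by_cases hj : j ∈ S
    · simp [Option.elim, hj]
    · simp [Option.elim, hj]
  rw [Fintype.sum_option, hnone, Finset.sum_congr rfl fun j _ => hsome j, Finset.sum_ite_mem,
    Finset.univ_inter]

/-- **Coefficients of a simplex-product piece.** For a square-free exponent `d`,
`coeff_d (E(t₀) · ∏_f (1 + Σ_{j ∈ S f} E(t f j))) = Σ_g [g live] · ∏_{s ∈ supp d} (t₀ s + Σ_f (g f).elim 0 (t f · s))`. -/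
theorem coeff_simplexPiece (t₀ : σ → ℂ) (t : Fin D → Fin N → σ → ℂ) (S : Fin D → Finset (Fin N))
    (d : σ →₀ ℕ) (hd : ∀ s, d s ≤ 1) :
    coeff d ((∏ v : σ, (1 + C (t₀ v) * X v)) *
        ∏ f : Fin D, (1 + ∑ j ∈ S f, ∏ v : σ, (1 + C (t f j v) * X v)) : MvPolynomial σ ℂ) =
      ∑ g : Fin D → Option (Fin N), (∏ f : Fin D, (g f).elim 1 fun j => if j ∈ S f then (1 : ℂ) else 0) *
        ∏ s ∈ d.support, (t₀ s + ∑ f : Fin D, (g f).elim 0 fun j => t f j s) := by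
  -- expand the product over factors into a sum over vertex choices `g`
  have hexp : (∏ f : Fin D, (1 + ∑ j ∈ S f, ∏ v : σ, (1 + C (t f j v) * X v)) : MvPolynomial σ ℂ) =
      ∑ g : Fin D → Option (Fin N), ∏ f : Fin D, (C ((g f).elim 1 fun j => if j ∈ S f then 1 else 0) *
        ∏ v : σ, (1 + C ((g f).elim 0 fun j => t f j v) * X v)) := by
    simp_rw [one_add_sum_elemProd_eq]
    rw [Finset.prod_univ_sum, Fintype.piFinset_univ]
  rw [hexp, Finset.mul_sum, coeff_sum]
  refine Finset.sum_congr rfl fun g _ => ?_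
  rw [Finset.prod_mul_distrib, ← map_prod, mul_left_comm, coeff_C_mul]
  congr 1
  -- the `g`-term is ONE product of elementary factors indexed by `Option (Fin D) × σ`
  set T : Option (Fin D) → σ → ℂ := fun o v => o.elim (t₀ v) fun f => (g f).elim 0 fun j => t f j v with hT
  have hprod : ((∏ v : σ, (1 + C (t₀ v) * X v)) *
      ∏ f : Fin D, ∏ v : σ, (1 + C ((g f).elim 0 fun j => t f j v) * X v) : MvPolynomial σ ℂ) =
      ∏ e ∈ (Finset.univ : Finset (Option (Fin D) × σ)), (1 + C (Function.uncurry T e) * X (Prod.snd e)) := by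
    rw [← Finset.univ_product_univ, Finset.prod_product, Fintype.prod_option]
    simp only [Function.uncurry_apply_pair, hT, Option.elim]
  rw [hprod, coeff_squarefree_prod_one_add_C_mul_X _ Prod.snd (Function.uncurry T) d hd]
  refine Finset.prod_congr rfl fun s _ => ?_
  rw [Finset.sum_filter, Fintype.sum_prod_type, Fintype.sum_option]
  have hin : ∀ o : Option (Fin D), (∑ v : σ, if Prod.snd (o, v) = s then Function.uncurry T (o, v) else 0) =
      T o s := by
    intro o
    simp only [Function.uncurry_apply_pair]
    rw [Finset.sum_ite_eq' Finset.univ s]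
    simp
  simp only [hin]
  rfl

end Coeff

/-! ## 2. The partition matrix of the simplex-product join -/

variable {h : ℕ}

/-- **The partition matrix of the simplex join.** On `(U, W)` the coefficient of `x^U y^W` in
`Σ_p E(tab p none) ∏_f (1 + Σ_{j ∈ S p f} E(tab p (f,j)))` is
`Σ_p Σ_g [g live in p] · ∏_{a∈U} (tab p none x_a + Σ_f (g f).elim 0 (tab p (f,·) x_a)) · (y-analogue)`. -/
theorem coeff_partition_simplexJoin {m D N : ℕ} (tab : Fin m → Option (Fin D × Fin N) → Fin (h + h) → ℂ)
    (S : Fin m → Fin D → Finset (Fin N)) (U W : Finset (Fin h)) :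
    coeff (∑ a ∈ U, Finsupp.single (Fin.castAdd h a) 1 + ∑ c ∈ W, Finsupp.single (Fin.natAdd h c) 1)
      (∑ p : Fin m, ((∏ v : Fin (h + h), (1 + C (tab p none v) * X v)) *
        ∏ f : Fin D, (1 + ∑ j ∈ S p f, ∏ v : Fin (h + h), (1 + C (tab p (some (f, j)) v) * X v))) :
        MvPolynomial (Fin (h + h)) ℂ) =
      ∑ p : Fin m, ∑ g : Fin D → Option (Fin N),
        (∏ f : Fin D, (g f).elim 1 fun j => if j ∈ S p f then (1 : ℂ) else 0) *
        ((∏ a ∈ U, (tab p none (Fin.castAdd h a) +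
            ∑ f : Fin D, (g f).elim 0 fun j => tab p (some (f, j)) (Fin.castAdd h a))) *
          ∏ c ∈ W, (tab p none (Fin.natAdd h c) +
            ∑ f : Fin D, (g f).elim 0 fun j => tab p (some (f, j)) (Fin.natAdd h c))) := by
  rw [coeff_sum]
  refine Finset.sum_congr rfl fun p _ => ?_
  rw [coeff_simplexPiece (tab p none) (fun f j => tab p (some (f, j))) (S p) _ (partitionExpo_le_one U W)]
  refine Finset.sum_congr rfl fun g _ => ?_
  congr 1
  exact prod_support_partitionExpo U W
    (fun s => tab p none s + ∑ f : Fin D, (g f).elim 0 fun j => tab p (some (f, j)) s)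

/-! ## 3. Size -/

/-- One factor `1 + Σ_{j∈S} E(t j)` has size `≤ N(6h+1) + N + 1`. -/
theorem complexity_factor_le {N : ℕ} (S : Finset (Fin N)) (t : Fin N → Fin (h + h) → ℂ) :
    complexity (1 + ∑ j ∈ S, ∏ v : Fin (h + h), (1 + C (t j v) * X v) : MvPolynomial (Fin (h + h)) ℂ) ≤
      N * (3 * (h + h)) + N + 1 := by
  calc complexity (1 + ∑ j ∈ S, ∏ v : Fin (h + h), (1 + C (t j v) * X v) : MvPolynomial (Fin (h + h)) ℂ)
      ≤ complexity (1 : MvPolynomial (Fin (h + h)) ℂ) +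
          complexity (∑ j ∈ S, ∏ v : Fin (h + h), (1 + C (t j v) * X v) : MvPolynomial (Fin (h + h)) ℂ) + 1 :=
        complexity_add_le_holds _ _
    _ ≤ 0 + (∑ j ∈ S, complexity (∏ v : Fin (h + h), (1 + C (t j v) * X v) : MvPolynomial (Fin (h + h)) ℂ) +
          S.card) + 1 := by
        gcongr
        · rw [← C_1, complexity_C_holds]
        · exact complexity_finset_sum_le _ _
    _ ≤ 0 + (∑ _j ∈ S, 3 * (h + h) + S.card) + 1 := by
        gcongr with j _; exact complexity_elemProd_le _
    _ = S.card * (3 * (h + h)) + S.card + 1 := by rw [Finset.sum_const, smul_eq_mul]; ring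
    _ ≤ N * (3 * (h + h)) + N + 1 := by
        have : S.card ≤ N := by simpa using Finset.card_le_univ S
        gcongr

/-- **Size of one piece**: `≤ 3(2h) + D(N·3(2h) + N + 1) + D + 1`. -/
theorem complexity_simplexPiece_le {D N : ℕ} (tab : Option (Fin D × Fin N) → Fin (h + h) → ℂ)
    (S : Fin D → Finset (Fin N)) :
    complexity ((∏ v : Fin (h + h), (1 + C (tab none v) * X v)) *
        ∏ f : Fin D, (1 + ∑ j ∈ S f, ∏ v : Fin (h + h), (1 + C (tab (some (f, j)) v) * X v)) :
        MvPolynomial (Fin (h + h)) ℂ) ≤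
      3 * (h + h) + (D * (N * (3 * (h + h)) + N + 1) + D) + 1 := by
  calc _ ≤ complexity (∏ v : Fin (h + h), (1 + C (tab none v) * X v) : MvPolynomial (Fin (h + h)) ℂ) +
        complexity (∏ f : Fin D, (1 + ∑ j ∈ S f, ∏ v : Fin (h + h), (1 + C (tab (some (f, j)) v) * X v)) :
          MvPolynomial (Fin (h + h)) ℂ) + 1 := complexity_mul_le_holds _ _
    _ ≤ 3 * (h + h) + (∑ f : Fin D, complexity (1 + ∑ j ∈ S f,
          ∏ v : Fin (h + h), (1 + C (tab (some (f, j)) v) * X v) : MvPolynomial (Fin (h + h)) ℂ) +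
          (Finset.univ : Finset (Fin D)).card) + 1 := by
        gcongr
        · exact complexity_elemProd_le _
        · exact complexity_finset_prod_le _ _
    _ ≤ 3 * (h + h) + (∑ _f : Fin D, (N * (3 * (h + h)) + N + 1) + (Finset.univ : Finset (Fin D)).card) + 1 := by
        gcongr with f _; exact complexity_factor_le _ _
    _ = 3 * (h + h) + (D * (N * (3 * (h + h)) + N + 1) + D) + 1 := by simp

/-- **Size of the simplex join**: `≤ m · (3(2h) + D(N·3(2h) + N + 1) + D + 1) + m`. -/
theorem complexity_simplexJoin_le {m D N : ℕ} (tab : Fin m → Option (Fin D × Fin N) → Fin (h + h) → ℂ)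
    (S : Fin m → Fin D → Finset (Fin N)) :
    complexity (∑ p : Fin m, ((∏ v : Fin (h + h), (1 + C (tab p none v) * X v)) *
        ∏ f : Fin D, (1 + ∑ j ∈ S p f, ∏ v : Fin (h + h), (1 + C (tab p (some (f, j)) v) * X v))) :
        MvPolynomial (Fin (h + h)) ℂ) ≤
      m * (3 * (h + h) + (D * (N * (3 * (h + h)) + N + 1) + D) + 1) + m := by
  calc _ ≤ ∑ p : Fin m, complexity ((∏ v : Fin (h + h), (1 + C (tab p none v) * X v)) *
        ∏ f : Fin D, (1 + ∑ j ∈ S p f, ∏ v : Fin (h + h), (1 + C (tab p (some (f, j)) v) * X v)) :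
        MvPolynomial (Fin (h + h)) ℂ) + (Finset.univ : Finset (Fin m)).card := complexity_finset_sum_le _ _
    _ ≤ ∑ _p : Fin m, (3 * (h + h) + (D * (N * (3 * (h + h)) + N + 1) + D) + 1) +
        (Finset.univ : Finset (Fin m)).card := by
        gcongr with p _; exact complexity_simplexPiece_le _ _
    _ = m * (3 * (h + h) + (D * (N * (3 * (h + h)) + N + 1) + D) + 1) + m := by simp

end

end Summit.ValiantsHypothesis.ValiantsHypothesis.Theorems.BarrierLever.SimplexJoin
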